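import Literature.Computability.ImplicitComplexity.STAEncIter
import HarnessLib

/-!
# GMR08 completeness infrastructure, VI: machine configurations as λ-terms and the delay line

Support file 6 for the completeness half of
`Literature.Computability.ImplicitComplexity.STACapturesP` (GMR08 Thm. 3.9), following the
encoding of Turing-machine configurations of Gaboardi–Ronchi Della Rocca (CSL 2007) as reused in
GMR08 §3.2 / GMR's PSPACE paper §5 ("ATMs Configurations", terms `Dec`, `F[c]`), adapted to
the tree's machine model — flat programs over several stacks (`FlatProg`, `step`):

* finite data are one-hot (`symT a ≐ oneHot (NS+1) (a+1)`, `botT ≐ oneHot (NS+1) 0` = "no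
  symbol", `pcT pc ≐ oneHot (H+1) (min pc H)`); a stack `[a₁,…,a_q]` built with the cell
  constructor `c : X ≐ Sym ⊸ α ⊸ α` is `λz. c a₁ (c a₂ (⋯ (c a_q z)))` (`encStack`; a
  configuration will be `λc₁ c₂. ⟨stack₀, …, stack_{KS-1}, pc⟩`, `encConf` of the sequel
  `STAEncStep.lean`, with two cell constructors — for the input cells and for the pre-allocated
  reservoir cells, each then used once in the program; cells remember their constructor: tags
  `Bool`);
* THE DELAY LINE (GMR's `F[c] ≐ λb z. let z be g,h,i in ⟨h i ∘ g, c, b⟩`): iterating `F[c]` over a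
  stack rebuilds it one cell late and hands out, besides the rebuilt tail, a SPARE linear copy
  of `c` and the top symbol: `Dst ≐ St ⊗ X ⊗ Sym`, `dstT`. Here the previous cell is committed by
  a case analysis on the previous symbol with CLOSED branches (`BrBot`, `BrSym a`) applied to the
  shared resources `h, g` (no additive `if`): `commitT ≐ λg h i. (i BrBot BrSym₀ ⋯) h g`;
* the reductions `reduces_restore` (`⟨g,h,i⟩ commitT →* ` the stack), `reduces_F_step`,
  `reduces_chain_F` (a whole stack through the delay line: `→* dstT`), with the σ-calculus facts
  they need; and the typings (in the zone form `HTz` of `STAEncZone`) of the pieces: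
  `HTz.brBot`, `HTz.brSym`, `HTz.commit`, `HTz.F`.

## References

* [GaboardiMarionRonchidellarocca2008] GMR08 §3.2, Thm. 3.9; M. Gaboardi, J.-Y. Marion,
  S. Ronchi Della Rocca, ACM TOCL 13 (2012) §5 (terms `Dec`, `F[c]`, `Com`); M. Gaboardi,
  S. Ronchi Della Rocca, CSL 2007, LNCS 4646, §5.
-/

namespace Literature.Computability.ImplicitComplexity

namespace STA

/-! ### σ-calculus odds and ends -/

/-- Substituting the spine arguments into a term renamed past all the binders gives it back.
[folklore] -/
theorem Term.substp_subL_rename_length (Ms : List Term) (M : Term) :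
    (M.rename (· + Ms.length)).substp (Term.subL Ms) = M := by
  rw [Term.substp_rename]
  refine (Term.substp_congr (fun i => ?_) M).trans (Term.substp_var M)
  simp [Term.subL]

/-- The same under `k` further binders. [folklore] -/
theorem Term.substp_up_subL_rename_far (Ms : List Term) (k : ℕ) (M : Term) :
    (M.rename (· + (k + Ms.length))).substp (Term.up^[k] (Term.subL Ms)) = M.rename (· + k) := by
  rw [Term.substp_rename, Term.rename_eq_substp]
  refine Term.substp_congr (fun i => ?_) M
  simp only [Function.comp_apply, Term.up_iterate_subL, show ¬(i + (k + Ms.length) < k) by omega, if_false]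
  have : Term.subL Ms (i + (k + Ms.length) - k) = .var i := by
    simp [Term.subL, show i + (k + Ms.length) - k = i + Ms.length by omega]
  rw [this]
  rfl

/-- `(λ. Q↑)` applied to the bound variable: `(Q[⇑succ])[0 ↦ 0] = Q`. [folklore] -/
theorem Term.subst0_var0_rename_lift (Q : Term) : (Q.rename (liftRen Nat.succ)).subst0 (.var 0) = Q := by
  rw [Term.subst0_eq_substp, Term.substp_rename]
  refine (Term.substp_congr (fun i => ?_) Q).trans (Term.substp_var Q)
  cases i <;> rfl

namespace Sim

/-! ### Finite data, cells, stacks, configurations -/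

/-- `St ≐ α ⊸ α` (stacks). [cite: GaboardiMarionRonchidellarocca2008, §3.2] -/
def St : LinTy := .limp 0 (.tvar 0) (.tvar 0)

/-- `Sym ≐ E_{NS+1}`: the symbols `a < NS` (index `a + 1`) and "no symbol" (index `0`), i.e.
the jump-table index `FlatProg.tblIdx`. [cite: GaboardiMarionRonchidellarocca2008, §3.2] -/
def SymT (NS : ℕ) : LinTy := tyE (NS + 1)

/-- `X ≐ Sym ⊸ α ⊸ α`: the type of a cell constructor `c`. [cite: GaboardiMarionRonchidellarocca2008, §3.2] -/
def X (NS : ℕ) : LinTy := .limp 0 (SymT NS) St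

/-- `Dst ≐ St ⊗ X ⊗ Sym`: a stack decomposed by the delay line (tail, spare cell constructor,
top symbol). [cite: GaboardiMarionRonchidellarocca2008, §3.2] -/
def Dst (NS : ℕ) : LinTy := tyTensN [St, X NS, SymT NS]

/-- The symbol `a` (`a < NS`). [cite: GaboardiMarionRonchidellarocca2008, §3.2] -/
def symT (NS a : ℕ) : Term := oneHot (NS + 1) (a + 1)

/-- "No symbol" (empty stack). [cite: GaboardiMarionRonchidellarocca2008, §3.2] -/
def botT (NS : ℕ) : Term := oneHot (NS + 1) 0

/-- The program counter `pc`, halted ones identified with `H`. [cite: GaboardiMarionRonchidellarocca2008, §3.2] -/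
def pcT (H pc : ℕ) : Term := oneHot (H + 1) (min pc H)

/-- The empty stack `I ≐ λz.z`. [cite: GaboardiMarionRonchidellarocca2008, §3.2] -/
def I : Term := .lam (.var 0)

/-- The dummy cell constructor `λb z. z` (spare copy of an empty stack). [cite: GaboardiMarionRonchidellarocca2008, §3.2] -/
def dummyX : Term := Term.lams 2 (.var 0)

variable (NS : ℕ)

/-- `c a₁ (c a₂ (⋯ (c a_q z)))` for the tagged cells `[(o₁,a₁),…]`, cell constructors `C o`.
[cite: GaboardiMarionRonchidellarocca2008, §3.2] -/
def chain (C : Bool → Term) (cells : List (Bool × ℕ)) (z : Term) : Term :=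
  cells.foldr (fun oa r => .app (.app (C oa.1) (symT NS oa.2)) r) z

/-- A stack: `λz. c a₁ (⋯ (c a_q z))` (constructors given outside the binder). [cite: GaboardiMarionRonchidellarocca2008, §3.2] -/
def encStack (C : Bool → Term) (cells : List (Bool × ℕ)) : Term :=
  .lam (chain NS (fun o => (C o).rename Nat.succ) cells (.var 0))

/-- The initial value of the delay line `⟨I, dummy, ⊥⟩`. [cite: GaboardiMarionRonchidellarocca2008, §3.2] -/
def initD : Term := Term.tuple [I, dummyX, botT NS]

/-- A decomposed stack: `⟨tail, spare constructor of the top cell, top symbol⟩`, `initD` if empty.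
[cite: GaboardiMarionRonchidellarocca2008, §3.2] -/
def dstT (C : Bool → Term) : List (Bool × ℕ) → Term
  | [] => initD NS
  | (o, a) :: rest => Term.tuple [encStack NS C rest, C o, symT NS a]

/-- Branch "previous cell absent": `λh g. g`. [cite: GaboardiMarionRonchidellarocca2008, §3.2] -/
def BrBot : Term := Term.lams 2 (.var 0)

/-- Branch "previous cell had symbol `a`": `λh g. λz. h a (g z)` (commit it). [cite: GaboardiMarionRonchidellarocca2008, §3.2] -/
def BrSym (a : ℕ) : Term := Term.lams 2 (.lam (.app (.app (.var 2) (symT NS a)) (.app (.var 1) (.var 0))))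

/-- The `NS + 1` branches, indexed like `Sym`. [cite: GaboardiMarionRonchidellarocca2008, §3.2] -/
def Brs : List Term := BrBot :: (List.range NS).map (BrSym NS)

/-- The body `(i Brs) h g` of the commit, binders `g h i` = indices `2 1 0`. [cite: GaboardiMarionRonchidellarocca2008, §3.2] -/
def commitBody : Term := ((Term.var 0).apps (Brs NS)).apps [.var 1, .var 2]

/-- `commitT ≐ λg h i. (i Brs) h g`: a decomposed stack restored. [cite: GaboardiMarionRonchidellarocca2008, §3.2] -/
def commitT : Term := Term.lams 3 (commitBody NS)

/-- **The delay line step** `F[c] ≐ λb z. let z be g,h,i in ⟨(i Brs) h g, c, b⟩` (the cell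
constructor `Cc` given at the depth of `F`). [cite: GaboardiMarionRonchidellarocca2008, §3.2] -/
def F (Cc : Term) : Term :=
  .lam (.lam (Term.letT 3 (.var 0) (Term.tuple [commitBody NS, Cc.rename (· + 5), .var 4])))

/-! ### Spines with owned locals (typing) -/

end Sim

/-- **A spine whose head and arguments own disjoint local slots** (slot `i` belongs to the head
if `owner i = 0`, to the argument `j` if `owner i = j + 1`), all sharing the string.
[cite: GaboardiMarionRonchidellarocca2008, Table 2 ((⊸E), (m))] -/
theorem HTz.appsOwn {r m k : ℕ} (hr : 2 ≤ r) {L : Ctx} (owner : ℕ → ℕ) {Hd : Term} {σs : List SoftTy} {A : LinTy}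
    (Ns : List Term) (hlen : Ns.length = σs.length)
    (hHd : HTz r m k (fun i => if owner i = 0 then L i else none) Hd ⟨0, LinTy.arrows σs A⟩)
    (hNs : ∀ j (hj : j < Ns.length), HTz r m k (fun i => if owner i = j + 1 then L i else none) (Ns.get ⟨j, hj⟩)
      (σs.get ⟨j, hlen ▸ hj⟩)) :
    HTz r m k L (Hd.apps Ns) ⟨0, A⟩ := by
  induction Ns generalizing Hd σs owner L with
  | nil =>
    cases σs with
    | nil => exact hHd.weakenL fun i _ hne => by by_cases h : owner i = 0 <;> simp_all
    | cons _ _ => simp at hlen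
  | cons N Ns ih =>
    cases σs with
    | nil => simp at hlen
    | cons σ σs =>
      simp only [List.length_cons, Nat.add_right_cancel_iff] at hlen
      rw [Term.apps_cons]
      have h0 := hNs 0 (by simp)
      simp only [List.get_eq_getElem, List.getElem_cons_zero, Nat.zero_add] at h0
      -- the head applied to the first argument owns the slots of both
      have happ : HTz r m k (fun i => if owner i ≤ 1 then L i else none) (.app Hd N) ⟨0, LinTy.arrows σs A⟩ := by
        refine HTz.app hr (fun i => ?_) hHd (h0.congrL fun i _ => by rfl)
        by_cases h0' : owner i = 0
        · left; simp [h0']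
        · by_cases h1 : owner i = 1
          · right; simp [h1]
          · left; simp [h0', h1, show ¬(owner i ≤ 1) by omega]
      refine ih (owner := fun i => owner i - 1) hlen (happ.congrL fun i _ => ?_) fun j hj => ?_
      · by_cases h : owner i ≤ 1
        · simp [h, show owner i - 1 = 0 by omega]
        · simp [h, show owner i - 1 ≠ 0 by omega]
      · have := hNs (j + 1) (by simp; omega)
        simp only [List.get_eq_getElem, List.getElem_cons_succ] at this ⊢
        refine this.congrL fun i _ => ?_
        by_cases h : owner i = j + 1 + 1
        · simp [h]
        · simp [h, show owner i - 1 ≠ j + 1 by omega]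

/-- **Case analysis in the zone form**: `e : E_n` with locals `L`, branches using no local slot.
[cite: GaboardiMarionRonchidellarocca2008, §3.2] -/
theorem HTz.caseE {r m k : ℕ} (hr : 2 ≤ r) {L : Ctx} {e : Term} {n : ℕ} (C : LinTy) {Fs : List Term}
    (he : HTz r m k L e ⟨0, tyE n⟩) (hlen : Fs.length = n)
    (hF : ∀ j (hj : j < Fs.length), HTz r m k (fun _ => none) (Fs.get ⟨j, hj⟩) ⟨0, C⟩) :
    HTz r m k L (e.apps Fs) ⟨0, C⟩ := by
  have h1 := he.allE C
  rw [tyE_inst] at h1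
  refine HTz.appsOwn hr (fun _ => 0) Fs (σs := List.replicate n ⟨0, C⟩) (by simp [hlen]) (by simpa using h1) fun j hj => ?_
  simpa using hF j hj

namespace Sim

variable {NS}

/-! ### Closedness and substitution -/

/-- Free variables of an iterated abstraction. [folklore] -/
theorem _root_.Literature.Computability.ImplicitComplexity.STA.Term.freeIn_lams_iff (n : ℕ) (M : Term) (i : ℕ) :
    (Term.lams n M).FreeIn i ↔ M.FreeIn (i + n) := by
  induction n generalizing i with
  | zero => rfl
  | succ n ih =>
    show (Term.lams n M).FreeIn (i + 1) ↔ _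
    rw [ih, Nat.add_right_comm, Nat.add_assoc]

/-- Free variables of a spine. [folklore] -/
theorem _root_.Literature.Computability.ImplicitComplexity.STA.Term.freeIn_apps_iff (M : Term) (Ns : List Term) (i : ℕ) :
    (M.apps Ns).FreeIn i ↔ M.FreeIn i ∨ ∃ N ∈ Ns, N.FreeIn i := by
  induction Ns generalizing M with
  | nil => simp
  | cons N Ns ih => simp [Term.apps, ih, Term.FreeIn, or_assoc]

/-- One-hot data are closed. [folklore] -/
theorem _root_.Literature.Computability.ImplicitComplexity.STA.oneHot_closed {n : ℕ} (hn : 0 < n) (i j : ℕ) :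
    ¬(oneHot n i).FreeIn j := by
  rw [oneHot, Term.freeIn_lams_iff]
  simp only [Term.FreeIn]
  omega

/-- `freeIn_symT` (bookkeeping). [folklore] -/
@[simp] theorem freeIn_symT (a i : ℕ) : (symT NS a).FreeIn i ↔ False :=
  iff_false_intro (oneHot_closed (by omega) _ _)
/-- `freeIn_botT` (bookkeeping). [folklore] -/
@[simp] theorem freeIn_botT (i : ℕ) : (botT NS).FreeIn i ↔ False := iff_false_intro (oneHot_closed (by omega) _ _)
/-- `freeIn_pcT` (bookkeeping). [folklore] -/
@[simp] theorem freeIn_pcT (H pc i : ℕ) : (pcT H pc).FreeIn i ↔ False := iff_false_intro (oneHot_closed (by omega) _ _)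
/-- `freeIn_I` (bookkeeping). [folklore] -/
@[simp] theorem freeIn_I (i : ℕ) : I.FreeIn i ↔ False := by simp [I, Term.FreeIn]
/-- `freeIn_dummyX` (bookkeeping). [folklore] -/
@[simp] theorem freeIn_dummyX (i : ℕ) : dummyX.FreeIn i ↔ False := by simp [dummyX, Term.lams, Term.FreeIn]
/-- `freeIn_brBot` (bookkeeping). [folklore] -/
@[simp] theorem freeIn_brBot (i : ℕ) : BrBot.FreeIn i ↔ False := by simp [BrBot, Term.lams, Term.FreeIn]
/-- `freeIn_brSym` (bookkeeping). [folklore] -/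
@[simp] theorem freeIn_brSym (a i : ℕ) : (BrSym NS a).FreeIn i ↔ False := by
  simp [BrSym, Term.lams, Term.FreeIn]

/-- The branches are closed. [folklore] -/
theorem brs_closed {B : Term} (hB : B ∈ Brs NS) (i : ℕ) : ¬B.FreeIn i := by
  simp only [Brs, List.mem_cons, List.mem_map, List.mem_range] at hB
  rcases hB with rfl | ⟨a, _, rfl⟩ <;> simp

/-- Free variables of the commit body are the three binders. [folklore] -/
theorem freeIn_commitBody {i : ℕ} (h : (commitBody NS).FreeIn i) : i < 3 := by
  simp only [commitBody, Term.freeIn_apps_iff, Term.FreeIn, List.mem_cons, List.not_mem_nil, or_false] at h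
  rcases h with (h | ⟨B, hB, h⟩) | ⟨N, hN, h⟩
  · omega
  · exact absurd h (brs_closed hB i)
  · rcases hN with rfl | rfl <;> simp [Term.FreeIn] at h <;> omega

/-- `freeIn_commitT` (bookkeeping). [folklore] -/
@[simp] theorem freeIn_commitT (i : ℕ) : (commitT NS).FreeIn i ↔ False := by
  rw [commitT, Term.freeIn_lams_iff]
  exact iff_false_intro fun h => by have := freeIn_commitBody h; omega

/-- Closed pieces are invariant under substitution. [folklore] -/
theorem symT_substp (a : ℕ) (τ : ℕ → Term) : (symT NS a).substp τ = symT NS a :=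
  Term.substp_eq_self_of_freeIn _ fun i h => by simp at h
/-- `botT_substp` (bookkeeping). [folklore] -/
theorem botT_substp (τ : ℕ → Term) : (botT NS).substp τ = botT NS :=
  Term.substp_eq_self_of_freeIn _ fun i h => by simp at h
/-- `pcT_substp` (bookkeeping). [folklore] -/
theorem pcT_substp (H pc : ℕ) (τ : ℕ → Term) : (pcT H pc).substp τ = pcT H pc :=
  Term.substp_eq_self_of_freeIn _ fun i h => by simp at h
/-- `symT_rename` (bookkeeping). [folklore] -/
theorem symT_rename (a : ℕ) (ρ : ℕ → ℕ) : (symT NS a).rename ρ = symT NS a :=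
  Term.rename_eq_self_of_freeIn _ fun i h => by simp at h
/-- `I_substp` (bookkeeping). [folklore] -/
theorem I_substp (τ : ℕ → Term) : I.substp τ = I := rfl
/-- `dummyX_substp` (bookkeeping). [folklore] -/
theorem dummyX_substp (τ : ℕ → Term) : dummyX.substp τ = dummyX := rfl
/-- `initD_substp` (bookkeeping). [folklore] -/
theorem initD_substp (τ : ℕ → Term) : (initD NS).substp τ = initD NS := by
  rw [initD, Term.tuple_substp]
  simp [I_substp, dummyX_substp, botT_substp]
/-- `commitT_substp` (bookkeeping). [folklore] -/
theorem commitT_substp (τ : ℕ → Term) : (commitT NS).substp τ = commitT NS :=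
  Term.substp_eq_self_of_freeIn _ fun i h => by simp at h
/-- `brs_substp` (bookkeeping). [folklore] -/
theorem brs_substp (τ : ℕ → Term) : (Brs NS).map (fun B => B.substp τ) = Brs NS := by
  conv_rhs => rw [← List.map_id (Brs NS)]
  exact List.map_congr_left fun B hB => Term.substp_eq_self_of_freeIn _ fun i h => absurd h (brs_closed hB i)

/-- `length_brs` (bookkeeping). [folklore] -/
@[simp] theorem length_brs : (Brs NS).length = NS + 1 := by simp [Brs]

/-- Substituting in a chain of cells. [folklore] -/
theorem chain_substp (C : Bool → Term) (cells : List (Bool × ℕ)) (z : Term) (τ : ℕ → Term) :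
    (chain NS C cells z).substp τ = chain NS (fun o => (C o).substp τ) cells (z.substp τ) := by
  induction cells with
  | nil => rfl
  | cons oa cells ih => simp [chain, Term.substp, symT_substp] at ih ⊢; rw [ih]

/-- Renaming a chain of cells. [folklore] -/
theorem chain_rename (C : Bool → Term) (cells : List (Bool × ℕ)) (z : Term) (ρ : ℕ → ℕ) :
    (chain NS C cells z).rename ρ = chain NS (fun o => (C o).rename ρ) cells (z.rename ρ) := by
  induction cells with
  | nil => rfl
  | cons oa cells ih => simp [chain, Term.rename, symT_rename] at ih ⊢; rw [ih]

/-- Substituting in a stack: only the cell constructors change. [folklore] -/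
theorem encStack_substp (C : Bool → Term) (cells : List (Bool × ℕ)) (τ : ℕ → Term) :
    (encStack NS C cells).substp τ = encStack NS (fun o => (C o).substp τ) cells := by
  simp only [encStack, Term.substp, chain_substp, Term.up_zero]
  congr 2
  funext o
  rw [Term.substp_rename, Term.rename_substp]
  rfl

/-- Renaming a stack. [folklore] -/
theorem encStack_rename (C : Bool → Term) (cells : List (Bool × ℕ)) (ρ : ℕ → ℕ) :
    (encStack NS C cells).rename ρ = encStack NS (fun o => (C o).rename ρ) cells := by
  simp only [encStack, Term.rename, chain_rename, liftRen]
  congr 2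
  funext o
  rw [Term.rename_rename, Term.rename_rename, liftRen_comp_succ]

/-- `subst0` through a renamed constructor. [folklore] -/
theorem chain_succ_subst0 (C : Bool → Term) (cells : List (Bool × ℕ)) (N : Term) :
    (chain NS (fun o => (C o).rename Nat.succ) cells (.var 0)).subst0 N = chain NS C cells N := by
  rw [Term.subst0_eq_substp, chain_substp]
  simp only [Term.substp, Term.consSub_zero]
  congr 1
  funext o
  rw [← Term.subst0_eq_substp, Term.subst0_rename_succ]

/-- Applying a stack to an argument runs its cells over it. [cite: GaboardiMarionRonchidellarocca2008, §3.2] -/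
theorem reduces_app_encStack (C : Bool → Term) (cells : List (Bool × ℕ)) (N : Term) :
    Reduces (.app (encStack NS C cells) N) (chain NS C cells N) := by
  have := Red.beta (chain NS (fun o => (C o).rename Nat.succ) cells (.var 0)) N
  rw [chain_succ_subst0] at this
  exact Relation.ReflTransGen.single this

/-! ### Decomposed stacks -/

variable (NS) in
/-- Tail component of a decomposed stack. [cite: GaboardiMarionRonchidellarocca2008, §3.2] -/
def dstG (C : Bool → Term) : List (Bool × ℕ) → Term
  | [] => I
  | _ :: rest => encStack NS C rest

/-- Spare-constructor component. [cite: GaboardiMarionRonchidellarocca2008, §3.2] -/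
def dstH (C : Bool → Term) : List (Bool × ℕ) → Term
  | [] => dummyX
  | (o, _) :: _ => C o

variable (NS) in
/-- Top-symbol component. [cite: GaboardiMarionRonchidellarocca2008, §3.2] -/
def dstI : List (Bool × ℕ) → Term
  | [] => botT NS
  | (_, a) :: _ => symT NS a

/-- `dstT_eq` (bookkeeping). [folklore] -/
theorem dstT_eq (C : Bool → Term) (cells : List (Bool × ℕ)) :
    dstT NS C cells = Term.tuple [dstG NS C cells, dstH C cells, dstI NS cells] := by
  cases cells with
  | nil => rfl
  | cons oa rest => obtain ⟨o, a⟩ := oa; rfl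

/-- The commit body with the components plugged in. [folklore] -/
theorem commitBody_substp_subL (g h i : Term) :
    (commitBody NS).substp (Term.subL [g, h, i]) = (i.apps (Brs NS)).apps [h, g] := by
  simp only [commitBody, Term.substp_apps, Term.substp, brs_substp, List.map_cons, List.map_nil]
  have e0 : Term.subL [g, h, i] 0 = i := by simp [Term.subL]
  have e1 : Term.subL [g, h, i] 1 = h := by simp [Term.subL]
  have e2 : Term.subL [g, h, i] 2 = g := by simp [Term.subL]
  rw [e0, e1, e2]

/-- The commit body is untouched by substitutions lifted past its three binders. [folklore] -/
theorem commitBody_substp_up3 (τ : ℕ → Term) : (commitBody NS).substp (Term.up^[3] τ) = commitBody NS := by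
  refine Term.substp_eq_self_of_freeIn _ fun i hi => ?_
  have := freeIn_commitBody hi
  rw [show Term.up^[3] τ = Term.up (Term.up (Term.up τ)) from rfl]
  rcases i with _ | _ | _ | i
  · rfl
  · rfl
  · rfl
  · omega

/-- **Committing**: `(i Brs) h g →β*` the stack whose decomposition is `⟨g, h, i⟩` (all
symbols `< NS`). [cite: GaboardiMarionRonchidellarocca2008, §3.2] -/
theorem reduces_commit (C : Bool → Term) (cells : List (Bool × ℕ)) (hc : ∀ oa ∈ cells, oa.2 < NS) :
    Reduces (((dstI NS cells).apps (Brs NS)).apps [dstH C cells, dstG NS C cells]) (encStack NS C cells) := by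
  cases cells with
  | nil =>
    -- `botT` selects `BrBot`, which returns `g = I`
    simp only [dstI, dstH, dstG]
    have h1 : Reduces ((botT NS).apps (Brs NS)) BrBot := by
      have := reduces_apps_oneHot (n := NS + 1) (i := 0) (by omega) (Brs NS) length_brs
      simpa [Brs, botT] using this
    refine ((Reduces.apps h1 _).trans ?_)
    have := reduces_apps_lams 2 (.var 0) [dummyX, I] rfl
    have e0 : Term.subL [dummyX, I] 0 = I := by simp [Term.subL]
    simp only [Term.substp, e0] at this
    exact this
  | cons oa rest =>
    obtain ⟨o, a⟩ := oa
    have ha : a < NS := hc (o, a) (by simp)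
    simp only [dstI, dstH, dstG]
    -- `symT a` selects `BrSym a`
    have h1 : Reduces ((symT NS a).apps (Brs NS)) (BrSym NS a) := by
      have := reduces_apps_oneHot (n := NS + 1) (i := a + 1) (by omega) (Brs NS) length_brs
      simpa [Brs, symT] using this
    refine ((Reduces.apps h1 _).trans ?_)
    -- `BrSym a h g →* λz. h a (g z)` and the inner redex `g z`
    have h2 := reduces_apps_lams 2 (.lam (.app (.app (.var 2) (symT NS a)) (.app (.var 1) (.var 0))))
      [C o, encStack NS C rest] rfl
    refine h2.trans ?_
    simp only [Term.substp, Term.up_zero, symT_substp]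
    have e2 : Term.up (Term.subL [C o, encStack NS C rest]) 2 = (C o).rename Nat.succ := by
      rw [Term.up_succ]; simp [Term.subL]
    have e1 : Term.up (Term.subL [C o, encStack NS C rest]) 1 = (encStack NS C rest).rename Nat.succ := by
      rw [Term.up_succ]; simp [Term.subL]
    rw [e2, e1]
    refine Reduces.lam (Reduces.appR _ ?_)
    rw [encStack, Term.rename]
    have := Red.beta ((chain NS (fun o => (C o).rename Nat.succ) rest (.var 0)).rename (liftRen Nat.succ)) (.var 0)
    rw [Term.subst0_var0_rename_lift] at this
    exact Relation.ReflTransGen.single this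

/-- **Restoring a decomposed stack**: `⟨g,h,i⟩ commitT →β*` the stack. [cite: GaboardiMarionRonchidellarocca2008, §3.2] -/
theorem reduces_restore (C : Bool → Term) (cells : List (Bool × ℕ)) (hc : ∀ oa ∈ cells, oa.2 < NS) :
    Reduces (.app (dstT NS C cells) (commitT NS)) (encStack NS C cells) := by
  rw [dstT_eq]
  have := reduces_letT_tuple [dstG NS C cells, dstH C cells, dstI NS cells] (commitBody NS) (n := 3) rfl
  rw [commitBody_substp_subL] at this
  exact this.trans (reduces_commit C cells hc)

/-- **One step of the delay line**: `F[c] a ⟨g,h,i⟩ →β* ⟨committed ⟨g,h,i⟩, c, a⟩`.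
[cite: GaboardiMarionRonchidellarocca2008, §3.2] -/
theorem reduces_F_step (Cc : Term) (C : Bool → Term) (a : ℕ) (rest : List (Bool × ℕ))
    (hc : ∀ oa ∈ rest, oa.2 < NS) :
    Reduces ((F NS Cc).apps [symT NS a, dstT NS C rest])
      (Term.tuple [encStack NS C rest, Cc, symT NS a]) := by
  -- the two outer β-steps
  have h1 := reduces_apps_lams 2 (Term.letT 3 (.var 0) (Term.tuple [commitBody NS, Cc.rename (· + 5), .var 4]))
    [symT NS a, dstT NS C rest] rfl
  refine h1.trans ?_
  rw [Term.letT_substp, Term.tuple_substp]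
  simp only [List.map_cons, List.map_nil, Term.substp, commitBody_substp_up3]
  have e0 : Term.subL [symT NS a, dstT NS C rest] 0 = dstT NS C rest := by simp [Term.subL]
  have e4 : (Term.up^[3] (Term.subL [symT NS a, dstT NS C rest])) 4 = symT NS a := by
    rw [Term.up_iterate_subL, if_neg (by omega)]
    simp [Term.subL, symT_rename]
  have e5 : (Cc.rename (· + 5)).substp (Term.up^[3] (Term.subL [symT NS a, dstT NS C rest])) = Cc.rename (· + 3) :=
    Term.substp_up_subL_rename_far [symT NS a, dstT NS C rest] 3 Cc
  rw [e0, e4, e5, dstT_eq]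
  -- the `let`
  have h2 := reduces_letT_tuple [dstG NS C rest, dstH C rest, dstI NS rest]
    (Term.tuple [commitBody NS, Cc.rename (· + 3), symT NS a]) (n := 3) rfl
  refine h2.trans ?_
  rw [Term.tuple_substp]
  simp only [List.map_cons, List.map_nil, commitBody_substp_subL, symT_substp]
  rw [show (Cc.rename (· + 3)).substp (Term.subL [dstG NS C rest, dstH C rest, dstI NS rest]) = Cc from
    Term.substp_subL_rename_length _ Cc]
  -- commit the first component
  exact Reduces.tuple (List.Forall₂.cons (reduces_commit C rest hc)
    (List.Forall₂.cons Relation.ReflTransGen.refl (List.Forall₂.cons Relation.ReflTransGen.refl List.Forall₂.nil)))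

/-- **A stack through the delay line**: iterating `F` (with constructor `C o` for the cells
tagged `o`) from `initD` over the cells yields the decomposed stack.
[cite: GaboardiMarionRonchidellarocca2008, §3.2 (behaviour of `Dec`)] -/
theorem reduces_chain_F (C : Bool → Term) (cells : List (Bool × ℕ)) (hc : ∀ oa ∈ cells, oa.2 < NS) :
    Reduces (chain NS (fun o => F NS (C o)) cells (initD NS)) (dstT NS C cells) := by
  induction cells with
  | nil => exact Relation.ReflTransGen.refl
  | cons oa rest ih =>
    obtain ⟨o, a⟩ := oa
    have hrest : ∀ oa ∈ rest, oa.2 < NS := fun oa h => hc oa (by simp [h])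
    simp only [chain, List.foldr_cons]
    refine (Reduces.appR _ (ih hrest)).trans ?_
    exact reduces_F_step (Cc := C o) C a rest hrest

/-! ### Typing the pieces (zone form) -/

section typing

variable {r m k : ℕ} {L : Ctx}

/-- `symT` (bookkeeping). [folklore] -/
theorem _root_.Literature.Computability.ImplicitComplexity.STA.HTz.symT {a : ℕ} (ha : a < NS) :
    HTz r m k L (symT NS a) ⟨0, SymT NS⟩ :=
  HTz.ofClosed (HT.oneHot (by omega))

/-- `botT` (bookkeeping). [folklore] -/
theorem _root_.Literature.Computability.ImplicitComplexity.STA.HTz.botT : HTz r m k L (botT NS) ⟨0, SymT NS⟩ :=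
  HTz.ofClosed (HT.oneHot (by omega))

/-- `pcT` (bookkeeping). [folklore] -/
theorem _root_.Literature.Computability.ImplicitComplexity.STA.HTz.pcT (H pc : ℕ) : HTz r m k L (pcT H pc) ⟨0, tyE (H + 1)⟩ :=
  HTz.ofClosed (HT.oneHot (by omega))

/-- `⊢ I : St`. [cite: GaboardiMarionRonchidellarocca2008, §3.2] -/
theorem _root_.Literature.Computability.ImplicitComplexity.STA.HTz.I : HTz r m k L I ⟨0, St⟩ :=
  HTz.lam (τ := ⟨0, .tvar 0⟩) (HTz.lvar (by omega) rfl)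

/-- `⊢ dummyX : X`. [cite: GaboardiMarionRonchidellarocca2008, §3.2] -/
theorem _root_.Literature.Computability.ImplicitComplexity.STA.HTz.dummyX : HTz r m k L dummyX ⟨0, X NS⟩ :=
  HTz.lam (τ := ⟨0, SymT NS⟩) (HTz.lam (τ := ⟨0, .tvar 0⟩) (HTz.lvar (by omega) rfl))

/-- The type of the commit branches `X ⊸ St ⊸ St`. [folklore] -/
def BrT (NS : ℕ) : LinTy := .limp 0 (X NS) (.limp 0 St St)

/-- `⊢ BrBot : X ⊸ St ⊸ St`. [cite: GaboardiMarionRonchidellarocca2008, §3.2] -/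
theorem _root_.Literature.Computability.ImplicitComplexity.STA.HTz.brBot : HTz r m k L BrBot ⟨0, BrT NS⟩ :=
  HTz.lam (τ := ⟨0, X NS⟩) (HTz.lam (τ := ⟨0, St⟩) (HTz.lvar (by omega) rfl))

/-- `⊢ BrSym a : X ⊸ St ⊸ St` (`a < NS`). [cite: GaboardiMarionRonchidellarocca2008, §3.2] -/
theorem _root_.Literature.Computability.ImplicitComplexity.STA.HTz.brSym (hr : 2 ≤ r) {a : ℕ} (ha : a < NS) :
    HTz r m k L (BrSym NS a) ⟨0, BrT NS⟩ := by
  refine HTz.lam (τ := ⟨0, X NS⟩) (HTz.lam (τ := ⟨0, St⟩) (HTz.lam (τ := ⟨0, .tvar 0⟩) ?_))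
  -- `h a (g z)` with `z = 0`, `g = 1`, `h = 2`
  refine HTz.app hr (q := 0) (B := .tvar 0) (L₁ := Ctx.cons none (Ctx.cons none (Ctx.cons (some ⟨0, X NS⟩) L)))
    (L₂ := fun i => if i = 0 then some ⟨0, .tvar 0⟩ else if i = 1 then some ⟨0, St⟩ else none) (fun i => ?_) ?_ ?_
  · rcases i with _ | _ | _ | i
    · right; simp [Ctx.cons]
    · right; simp [Ctx.cons]
    · left; simp [Ctx.cons]
    · left; simp [Ctx.cons]
  · exact (HTz.lvar (A := X NS) (by omega) (by simp [Ctx.cons])).app_closed_arg (q := 0) (B := SymT NS) (A := St)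
      (HT.oneHot (by omega))
  · refine HTz.app hr (q := 0) (B := .tvar 0) (L₁ := fun i => if i = 1 then some ⟨0, St⟩ else none)
      (L₂ := fun i => if i = 0 then some ⟨0, .tvar 0⟩ else none) (fun i => ?_) (HTz.lvar (by omega) (by simp [St]))
      (HTz.lvar (by omega) (by simp))
    rcases i with _ | _ | i
    · right; simp
    · left; simp
    · left; simp

/-- The branches, as a family. [cite: GaboardiMarionRonchidellarocca2008, §3.2] -/
theorem _root_.Literature.Computability.ImplicitComplexity.STA.HTz.brs (hr : 2 ≤ r) (j : ℕ) (hj : j < (Brs NS).length) :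
    HTz r m k (fun _ => none) ((Brs NS).get ⟨j, hj⟩) ⟨0, BrT NS⟩ := by
  cases j with
  | zero => exact HTz.brBot
  | succ j =>
    have hj' : j < NS := by simpa [Brs] using hj
    simp only [Brs, List.get_eq_getElem, List.getElem_cons_succ, List.getElem_map, List.getElem_range]
    exact HTz.brSym hr hj'

/-- **The commit spine** `(i Brs) h g : St` for local slots `g : St`, `h : X`, `i : Sym`.
[cite: GaboardiMarionRonchidellarocca2008, §3.2] -/
theorem _root_.Literature.Computability.ImplicitComplexity.STA.HTz.commit (hr : 2 ≤ r) {g h i : ℕ}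
    (hg : g < k) (hh : h < k) (hi : i < k) (hgh : g ≠ h) (hhi : h ≠ i) (hgi : g ≠ i)
    (hLg : L g = some ⟨0, St⟩) (hLh : L h = some ⟨0, X NS⟩) (hLi : L i = some ⟨0, SymT NS⟩) :
    HTz r m k L (((Term.var i).apps (Brs NS)).apps [.var h, .var g]) ⟨0, St⟩ := by
  have hcase : HTz r m k (fun j => if j = i then L j else none) ((Term.var i).apps (Brs NS)) ⟨0, BrT NS⟩ :=
    HTz.caseE hr (BrT NS) (n := NS + 1) (HTz.lvar hi (by simp [hLi, SymT])) length_brs (HTz.brs hr)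
  refine HTz.appsOwn hr (fun j => if j = i then 0 else if j = h then 1 else if j = g then 2 else 3) [.var h, .var g]
    (σs := [⟨0, X NS⟩, ⟨0, St⟩]) rfl (hcase.congrL fun j _ => ?_) fun j hj => ?_
  · by_cases hji : j = i
    · subst hji; simp
    · have hne : (if j = h then 1 else if j = g then 2 else 3) ≠ 0 := by split_ifs <;> omega
      simp [hji, hne]
  · rcases j with _ | _ | j
    · refine HTz.lvar hh ?_
      simp [hhi, hLh]
    · refine HTz.lvar hg ?_
      simp [hgi, hgh, hLg]
    · simp at hj

/-- **Typing the delay-line step**: `c : X ⊢ F[c] : Sym ⊸ Dst ⊸ Dst` for a local slot `c`.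
[cite: GaboardiMarionRonchidellarocca2008, §3.2 ("`⊢ Dec : ATM_i ⊸ ID_i`")] -/
theorem _root_.Literature.Computability.ImplicitComplexity.STA.HTz.F (hr : 2 ≤ r) {Cc : Term}
    (hC : HTz r m k L Cc ⟨0, X NS⟩) :
    HTz r m k L (F NS Cc) ⟨0, .limp 0 (SymT NS) (.limp 0 (Dst NS) (Dst NS))⟩ := by
  refine HTz.lam (τ := ⟨0, SymT NS⟩) (HTz.lam (τ := ⟨0, Dst NS⟩) ?_)
  -- `let z be g,h,i in ⟨…⟩`: `z` (slot 0) to the left, `b` (slot 1) and the locals of `Cc` to the right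
  refine HTz.letT hr (L₁ := fun j => if j = 0 then some ⟨0, Dst NS⟩ else none)
    (L₂ := Ctx.cons none (Ctx.cons (some ⟨0, SymT NS⟩) L))
    (As := [St, X NS, SymT NS]) (fun j => ?_) (HTz.lvar (by omega) (by simp [Dst])) ?_
  · rcases j with _ | _ | j
    · left; simp [Ctx.cons]
    · right; simp [Ctx.cons]
    · right; simp [Ctx.cons]
  · -- the tuple `⟨(i Brs) h g, c, b⟩` at depth `k + 5`
    show HTz r m (k + 2 + 3) _ _ _
    simp only [List.map_cons, List.map_nil, Ctx.pushL_cons, Ctx.pushL_nil]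
    refine HTz.tuple hr (fun j => if j < 3 then 0 else if j < 5 then 2 else 1)
      [commitBody NS, Cc.rename (· + 5), .var 4] [St, X NS, SymT NS] rfl fun j hj => ?_
    rcases j with _ | _ | _ | j
    · -- the commit, slots `2 1 0`
      refine HTz.commit hr (g := 2) (h := 1) (i := 0) (by omega) (by omega) (by omega) (by omega) (by omega) (by omega)
        ?_ ?_ ?_ <;> simp [Ctx.cons]
    · -- the constructor, five binders deeper
      have h5 := ((((hC.shift_succ none).shift_succ none).shift_succ none).shift_succ none).shift_succ none
      simp only [Term.rename_rename] at h5
      have e : (Nat.succ ∘ Nat.succ ∘ Nat.succ ∘ Nat.succ ∘ Nat.succ) = (· + 5) := rfl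
      rw [e] at h5
      refine (h5.congrL fun i _ => ?_)
      rcases i with _ | _ | _ | _ | _ | i
      · simp [Ctx.cons]
      · simp [Ctx.cons]
      · simp [Ctx.cons]
      · simp [Ctx.cons]
      · simp [Ctx.cons]
      · simp [Ctx.cons, show ¬(i + 1 + 1 + 1 + 1 + 1 < 3) by omega, show ¬(i + 1 + 1 + 1 + 1 + 1 < 5) by omega]
    · refine HTz.lvar (i := 4) (by omega) ?_
      simp [Ctx.cons]
    · exfalso; simp at hj; omega

end typing

end Sim

end STA

end Literature.Computability.ImplicitComplexity
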